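/-
Copyright (c) 2026. All rights reserved.
Released under Apache 2.0 license as described in the file LICENSE.
Authors: abc-iut cell, prover seat abc-iut-L4-t5 (gen 10; row «F3757-PORT», abc-iut-L4-lead m147 (5)), over abc-iut-L4-t15's
`LogFrobeniusTelecoreProofs.lean`, abc-iut-w5-d144's `LogFrobeniusObservablesOver.lean` / `…TSOver.lean` and this lineage's
universal-family toolkit (`DiagramUniversalTelecores.lean`).
-/
import Literature.AnabelianGeometry.AbsoluteAnabelian.DiagramOverHomotopies
import Literature.AnabelianGeometry.AbsoluteAnabelian.DiagramPathEmbeddings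
import Literature.AnabelianGeometry.AbsoluteAnabelian.LogFrobeniusObservablesTelecore
import Literature.AnabelianGeometry.AbsoluteAnabelian.LogFrobeniusObservablesOver
import Literature.AnabelianGeometry.AbsoluteAnabelian.LogFrobeniusObservablesTSOver
import HarnessLib

/-!
# [AbsTopIII] Cor 5.5 (ii)/(iii): the telecore diagram `D_{An•}` over `Th•[Z]` — structure functors, the telecore `𝔗_{An•}`,
# and the three sub-observables `S_log⊞_v`, `S_log_v`, `ℰ•` read inside it (toolkit for the compatibility clause of (iii))

S. Mochizuki, *Topics in absolute anabelian geometry III: global reconstruction algorithms*,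
J. Math. Sci. Univ. Tokyo 22 (2015) 939–1156 [MochizukiAbsTopIII2015]; manuscript `paper:url-5493eb38cbb7`, locators read on the
page: Cor 5.5 (i)–(iii) pp. 130–131 (the cores `ℰ•`, `An•[𝒳]`, the telecore `𝔗_{An•}` with edges `φ_⋏ = φ_{An•}`, the observables
`S_log⊞_v`, `S_log_v`, and "the families of homotopies that constitute `S_log` and `S_log⊞` are compatible with one another as well
as with the families of homotopies that constitute the core and telecore structures of (i), (ii)"), Def 5.4 (ii)/(iv) pp. 125–127
("lies over `Th•`" / "lie over `Th•[Z]`"), Rmk 3.5.1 p. 78 (structure functors, "constant portion under the diagram").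

WHAT (row «F3757-PORT» = FACT-LIST F-3757 `Cor55ObservablesTelecoreCompatible` at the genuine carriers, file 1 of the mover).
The telecore diagram `D_{An•}` = `D•_{≤5} ∪ {An•[𝒳]}` with the telecore edges `φ_⋏ : An•[𝒳] → 𝒳_⋏` (abc-iut-L4-t3's
`anTelecoreDiagram`) LIES OVER `Th•[Z] = ℰ•` through PLAIN structure functors — `𝒳_⋎, □ ↦ proj`, `𝒩⊞_v ↦ (𝒩⊞_v → 𝒩_v → ℰ•)`,
`𝒩_v ↦ (𝒩_v → ℰ•)`, `ℰ• ↦ 𝟭`, `An•[𝒳] ↦ κ_{An•}⁻¹` — chosen so that they RESTRICT LITERALLY to abc-iut-w5-d144's over-data of the two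
observables (`logPlusOverE v`, `logTSOverE v`: same functors, same over-isomorphisms `logOver`, unitor, `lamOver`, identity):

* `anBaseOverE`, `anObsIso`, `anTelIso`, `anOverE` — the over-datum (abc-iut-L4-t12's `OverData`) on `D_{An•}`; the telecore edges
  lie over `ℰ•` by `φ_{An•} ⋙ proj ≅ κ_{An•}⁻¹` (from abc-iut-L4-t15's `telecoreEdgeIso : φ_{An•} ⋙ π_{An•} ≅ 𝟭`);
* `anOverE_ff_obs`, `anOverE_ff_e5` — FULLY FAITHFUL structure functors at the two core vertices `An•[𝒳]` (`κ_{An•}⁻¹`) and `ℰ•`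
  (`𝟭`) of `D_{An•}` (so abc-iut-L4-t5's lifts `OverData.lift` live there); `proj_faithful` — `proj : Th•_T[Z] → Th•[Z]` is
  FAITHFUL for every setting (`η_{An•} : π_{An•} ⋙ φ_{An•} ≅ 𝟭`);
* `anTelecoreE` — the telecore `𝔗_{An•}` of Cor 5.5 (ii) over the universal core at `An•[𝒳]` for THIS over-datum
  (`univTelecore`; telecore edges `TelecoreIdx` / `telecoreFun` on the nose) — a second witness of abc-iut-L4-t3's `Cor55Telecore`
  next to abc-iut-L4-t15's `cor55Telecore_holds` (`cor55Telecore_of_anTelecoreE`);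
* `embObs` — the common shape of the three graph inclusions `Γ⃗_{D•_{≤2} ∪ {𝒩⊞_v}}`, `Γ⃗_{(D•_{≤3})_v ∪ {𝒩_v}}`, `Γ⃗_{D•_{≤4} ∪ {ℰ•}}`
  `↪ Γ⃗_{D_{An•}}` of abc-iut-L4-t3 (`embPlus`, `embTS`, `embE5` agree with `embObs` vertex-by-vertex and arrow-by-arrow), an embedding of oriented graphs
  (abc-iut-f-101's `GraphEmbedding`) landing in base vertices; `pathFunctor_embObs` — the path functors agree along it.

Pure category-theoretic bookkeeping over abc-iut-L4-t2's honest Def. 3.5 definitions; interface-level (no carrier); nothing here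
bears on [IUTchIII] Cor. 3.12; no side taken; typed ≠ proved.
-/

set_option autoImplicit false

universe u

open CategoryTheory Quiver

namespace Literature.AnabelianGeometry.AbsoluteAnabelian

namespace LogFrobeniusSetting

open DiagramOfCategories

variable {Vmod : Type u} {isArc : Vmod → Bool} (L : LogFrobeniusSetting Vmod isArc)

/-! ## The telecore edges and the shape of `D_{An•}` (abbreviations) -/

/-- The telecore edges of `𝔗_{An•}` on the vertices of `D•_{≤5}`: one edge `φ_⋏` to each `𝒳_⋏`, `⋏ ∈ L ∪ {□}` (abc-iut-L4-t3's
`TelecoreIdx`). [cite: MochizukiAbsTopIII2015, Cor 5.5 (ii) p. 130] -/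
abbrev anJ : DSub (InFive (Vmod := Vmod) (isArc := isArc)) → Type u := fun a => TelecoreIdx a.1

/-- Their functors: copies of `φ_{An•}` (abc-iut-L4-t3's `telecoreFun`). [cite: MochizukiAbsTopIII2015, Cor 5.5 (ii) p. 130] -/
abbrev anTel : ∀ {a : DSub (InFive (Vmod := Vmod) (isArc := isArc))}, anJ a → (L.An ⥤ a.1.category L) :=
  fun {a} j => L.telecoreFun a.1 j

/-- The extended oriented graph `Γ⃗_{D_{An•}}`: `D•_{≤5}`, the core vertex `An•[𝒳]`, observation edges the arrows of `D•` into it,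
telecore edges `φ_⋏`. [cite: MochizukiAbsTopIII2015, Cor 5.5 (ii) p. 130] -/
abbrev anShape : ExtShape.{u} (DSub (InFive (Vmod := Vmod) (isArc := isArc))) := anTelecoreShape anJ

/-- The observable shape `D•_{≤5} ∪ {An•[𝒳]}` (no telecore edges) underlying the core of Cor 5.5 (i), `n = 6`.
[cite: MochizukiAbsTopIII2015, Cor 5.5 (i) p. 130] -/
abbrev anObsShape : ExtShape.{u} (DSub (InFive (Vmod := Vmod) (isArc := isArc))) := obsShape InFive DVertex.an

/-- The telecore diagram `D_{An•}` as a diagram of categories (abc-iut-L4-t3's `anTelecoreDiagram` at the printed edges).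
[cite: MochizukiAbsTopIII2015, Cor 5.5 (ii) p. 130] -/
abbrev anDiagram : DiagramOfCategories.{u, u + 1, u} (anShape (Vmod := Vmod) (isArc := isArc)).Vertex :=
  L.anTelecoreDiagram anJ L.anTel

/-! ## The structure functors of `D•_{≤5}` over `Th•[Z]` (plain, as in the observables' over-data) -/

/-- Structure functor of a vertex of `D•_{≤5}` towards `Th•[Z] = ℰ•`: `𝒳_⋎, □ ↦ proj`, `𝒩⊞_v ↦ 𝒩⊞_v → 𝒩_v → Th•[Z]`,
`𝒩_v ↦ 𝒩_v → Th•[Z]`, `ℰ• ↦ 𝟭` (Rmk 3.5.1; Def 5.4 (i)/(iv)). [cite: MochizukiAbsTopIII2015, Remark 3.5.1 p.78] -/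
def baseN : (x : DVertex Vmod isArc) → InFive (isArc := isArc) x → (x.category L ⥤ L.E)
  | .row1 _, _ => L.proj
  | .core, _ => L.proj
  | .nplus v, _ => L.forget v ⋙ L.toE v
  | .nv v, _ => L.toE v
  | .e5, _ => 𝟭 L.E
  | .an, h => absurd h.2 (by change ¬ (6 ≤ 5); decide)
  | .e7, h => absurd h.2 (by change ¬ (7 ≤ 5); decide)
  | .nmonoPlus _, h => h.1.elim
  | .nmono _, h => h.1.elim
  | .emono5, h => h.1.elim
  | .anMono, h => h.1.elim
  | .emono7, h => h.1.elim

/-- The arrows of `D•_{≤5}` lie over `Th•[Z]`: `log` by `logOver` (Def 5.4 (ii)), `id_⋎` by the unitor, `λ⊞_{v,ν}` by `lamOver v ν`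
(Def 5.4 (iv)), `𝒩⊞_v → 𝒩_v` and `𝒩_v → ℰ•` by the identity / unitor — literally the over-isomorphisms of abc-iut-w5-d144's
`logPlusOverE`, `logTSOverE`. [cite: MochizukiAbsTopIII2015, Def 5.4 (iv) p. 127] -/
def baseμ : ∀ {x y : DVertex Vmod isArc} (e : DEdge isArc x y) (hx : InFive (isArc := isArc) x) (hy : InFive (isArc := isArc) y),
    DEdge.functor L e ⋙ L.baseN y hy ≅ L.baseN x hx
  | _, _, .log _, _, _ => L.logOver
  | _, _, .toCore _, _, _ => L.proj.leftUnitor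
  | _, _, .lam v ν _, _, _ => L.lamOver v ν
  | _, _, .forget _, _, _ => Iso.refl _
  | _, _, .toE v, _, _ => (L.toE v).rightUnitor
  | _, _, .κAn, _, hy => absurd hy.2 (by change ¬ (6 ≤ 5); decide)
  | _, _, .anToE, hx, _ => absurd hx.2 (by change ¬ (6 ≤ 5); decide)
  | _, _, .monoNplus _, _, hy => hy.1.elim
  | _, _, .monoN _, _, hy => hy.1.elim
  | _, _, .monoE5, _, hy => hy.1.elim
  | _, _, .monoAn, _, hy => hy.1.elim
  | _, _, .monoE7, _, hy => hy.1.elim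
  | _, _, .forgetMono _, hx, _ => hx.1.elim
  | _, _, .toEmono _, hx, _ => hx.1.elim
  | _, _, .κAnMono, hx, _ => hx.1.elim
  | _, _, .anMonoToE, hx, _ => hx.1.elim

/-- **`D•_{≤5}` over `Th•[Z]`** (abc-iut-L4-t12's `OverData`): the plain structure functors and over-isomorphisms above.
[cite: MochizukiAbsTopIII2015, Remark 3.5.1 p.78] -/
def anBaseOverE : (L.subdiagram (InFive (isArc := isArc))).OverData L.E where
  N a := L.baseN a.1 a.2
  μ e := L.baseμ e _ _

/-- The observation arrow `κ_{An•} : ℰ• → An•[𝒳]` lies over `Th•[Z]` through `κ_{An•}⁻¹` at the core vertex: `κ_{An•} ⋙ κ_{An•}⁻¹ ≅ 𝟭`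
(Cor 5.2 (iv): `κ_{An•}` is an equivalence). [cite: MochizukiAbsTopIII2015, Cor 5.5 (i) p. 130] -/
noncomputable def anObsIso : ∀ (a : DSub (InFive (Vmod := Vmod) (isArc := isArc))) (i : DEdge isArc a.1 .an),
    DEdge.functor L i ⋙ L.κAn.inverse ≅ L.anBaseOverE.N a
  | ⟨_, _⟩, .κAn => L.κAn.unitIso.symm

/-- The telecore functor `φ_{An•}` lies over `Th•[Z]`: `φ_{An•} ⋙ proj ≅ κ_{An•}⁻¹`, from `φ_{An•} ⋙ π_{An•} ≅ 𝟭` (abc-iut-L4-t15's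
`telecoreEdgeIso`, `π_{An•} = proj ⋙ κ_{An•}`). [cite: MochizukiAbsTopIII2015, Cor 5.5 (ii) p. 130] -/
noncomputable def φAnOverE : L.φAn ⋙ L.proj ≅ L.κAn.inverse :=
  (L.φAn ⋙ L.proj).rightUnitor.symm ≪≫ Functor.isoWhiskerLeft (L.φAn ⋙ L.proj) L.κAn.unitIso ≪≫
    (Functor.associator _ _ _).symm ≪≫
    Functor.isoWhiskerRight ((Functor.associator _ _ _) ≪≫ L.telecoreEdgeIso) L.κAn.inverse ≪≫ L.κAn.inverse.leftUnitor

/-- The telecore edges `φ_⋏ = φ_{An•}`, `⋏ ∈ L ∪ {□}`, lie over `Th•[Z]`. [cite: MochizukiAbsTopIII2015, Cor 5.5 (ii) p. 130] -/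
noncomputable def anTelIso : ∀ (a : DSub (InFive (Vmod := Vmod) (isArc := isArc))) (j : anJ a),
    L.anTel j ⋙ L.anBaseOverE.N a ≅ L.κAn.inverse
  | ⟨.row1 _, _⟩, _ => L.φAnOverE
  | ⟨.core, _⟩, _ => L.φAnOverE
  | ⟨.nplus _, _⟩, j => PEmpty.elim j
  | ⟨.nv _, _⟩, j => PEmpty.elim j
  | ⟨.e5, _⟩, j => PEmpty.elim j
  | ⟨.an, _⟩, j => PEmpty.elim j
  | ⟨.e7, _⟩, j => PEmpty.elim j
  | ⟨.nmonoPlus _, _⟩, j => PEmpty.elim j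
  | ⟨.nmono _, _⟩, j => PEmpty.elim j
  | ⟨.emono5, _⟩, j => PEmpty.elim j
  | ⟨.anMono, _⟩, j => PEmpty.elim j
  | ⟨.emono7, _⟩, j => PEmpty.elim j

/-- **The telecore diagram `D_{An•}` over `Th•[Z]`**: `anBaseOverE` on `D•_{≤5}`, `κ_{An•}⁻¹` at the core vertex `An•[𝒳]`, the
observation arrow and the telecore edges lying over by `anObsIso`, `anTelIso` (this lineage's `teleOver`).
[cite: MochizukiAbsTopIII2015, Remark 3.5.1 p.78] -/
noncomputable def anOverE : L.anDiagram.OverData L.E :=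
  teleOver (D := L.subdiagram InFive) anObsShape (L.obsExt InFive .an) L.anBaseOverE L.κAn.inverse L.anObsIso anJ L.anTel
    L.anTelIso

/-- The structure functor at the core vertex `An•[𝒳]` is `κ_{An•}⁻¹`. [cite: MochizukiAbsTopIII2015, Remark 3.5.1 p.78] -/
@[simp] theorem anOverE_N_obs : L.anOverE.N (anShape (Vmod := Vmod) (isArc := isArc)).obs = L.κAn.inverse := rfl

/-- The structure functor at a vertex of `D•_{≤5}` is the plain one. [cite: MochizukiAbsTopIII2015, Remark 3.5.1 p.78] -/
@[simp] theorem anOverE_N_base (a : DSub (InFive (Vmod := Vmod) (isArc := isArc))) :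
    L.anOverE.N ((anShape (Vmod := Vmod) (isArc := isArc)).base a) = L.baseN a.1 a.2 := rfl

/-- At the core vertex `An•[𝒳]` the structure functor `κ_{An•}⁻¹` is fully faithful. [cite: MochizukiAbsTopIII2015, Cor 5.5 (i) p. 130] -/
noncomputable def anOverE_ff_obs : (L.anOverE.N (anShape (Vmod := Vmod) (isArc := isArc)).obs).FullyFaithful :=
  L.κAn.fullyFaithfulInverse

/-- At the core vertex `ℰ•` (row 5) the structure functor `𝟭` is fully faithful. [cite: MochizukiAbsTopIII2015, Cor 5.5 (i) p. 130] -/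
def anOverE_ff_e5 : (L.anOverE.N ((anShape (Vmod := Vmod) (isArc := isArc)).base ⟨.e5, e5_mem_five⟩)).FullyFaithful :=
  Functor.FullyFaithful.id L.E

/-- **`proj : Th•_T[Z] → Th•[Z]` is faithful** for every setting: `(proj ⋙ κ_{An•}) ⋙ φ_{An•} ≅ 𝟭` (`η_{An•}`).
[cite: MochizukiAbsTopIII2015, Cor 5.5 p. 130] -/
theorem proj_faithful : L.proj.Faithful :=
  Functor.Faithful.of_comp_iso (F := L.proj) (G := L.κAn.functor ⋙ L.φAn) (H := 𝟭 L.X) L.ηAn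

/-- Hence the structure functors at `𝒳_⋎` and `□` are faithful (at most one over-homotopy into them, abc-iut-f-101's
`IsOver.eq_of_faithful`). [cite: MochizukiAbsTopIII2015, Remark 3.5.1 p.78] -/
theorem anOverE_faithful_row1 (n : ℤ) :
    (L.anOverE.N ((anShape (Vmod := Vmod) (isArc := isArc)).base ⟨.row1 n, row1_mem_five n⟩)).Faithful :=
  L.proj_faithful

/-- The structure functor at `□` is faithful. [cite: MochizukiAbsTopIII2015, Remark 3.5.1 p.78] -/
theorem anOverE_faithful_core :
    (L.anOverE.N ((anShape (Vmod := Vmod) (isArc := isArc)).base ⟨.core, core_mem_five⟩)).Faithful :=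
  L.proj_faithful

/-! ## The telecore `𝔗_{An•}` over the universal core at `An•[𝒳]`, for this over-datum -/

/-- The set of fully faithful vertices used for the telecore family: the core vertex only (Def 3.5 (iv) (b)).
[cite: MochizukiAbsTopIII2015, Definition 3.5 (iv) p.76] -/
theorem anOverE_ff_of_eq_obs : ∀ w : (anShape (Vmod := Vmod) (isArc := isArc)).Vertex,
    w = (anShape (Vmod := Vmod) (isArc := isArc)).obs → Nonempty (L.anOverE.N w).FullyFaithful := by
  rintro w rfl
  exact ⟨L.anOverE_ff_obs⟩

/-- Fully faithful structure at the vertices of `W = {An•[𝒳]}` (as data). [cite: MochizukiAbsTopIII2015, Definition 3.5 (iv) p.76] -/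
noncomputable def anW_ff (w : (anShape (Vmod := Vmod) (isArc := isArc)).Vertex)
    (hw : w = (anShape (Vmod := Vmod) (isArc := isArc)).obs) : (L.anOverE.N w).FullyFaithful :=
  Classical.choice (L.anOverE_ff_of_eq_obs w hw)

variable [Nonempty Vmod]

/-- The core structure of `D•_{≤6}` on `D•_{≤5}` (core vertex `An•[𝒳]`, Cor 5.5 (i), `n = 6`) determined by the over-datum: its
homotopies are the lifts through `κ_{An•}⁻¹` (this lineage's `univCoreObs`). [cite: MochizukiAbsTopIII2015, Cor 5.5 (i) p. 130] -/
theorem anCoreObsE_isCore :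
    (univCoreObs (D := L.subdiagram InFive) anObsShape (fun _ => (inferInstance : IsEmpty PEmpty.{u + 1}))
      (L.obsExt InFive .an) L.anBaseOverE L.κAn.inverse L.anObsIso L.κAn.fullyFaithfulInverse).IsCore :=
  univCoreObs_isCore _ _ _ _ _ _ _ reach_an

/-- **The telecore `𝔗_{An•}` of Cor 5.5 (ii) for this over-datum**: telecore edges `φ_⋏ = φ_{An•}` (`TelecoreIdx`, `telecoreFun`
on the nose), family `𝒥` = the lifts at `An•[𝒳]` whiskered by the common suffix, over the universal core (this lineage's
`univTelecore`; `V(F_mod) ≠ ∅` for the core condition). [cite: MochizukiAbsTopIII2015, Cor 5.5 (ii) pp. 130–131] -/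
noncomputable def anTelecoreE : Telecore (L.subdiagram InFive) _ L.anCoreObsE_isCore :=
  univTelecore (D := L.subdiagram InFive) anObsShape (fun _ => (inferInstance : IsEmpty PEmpty.{u + 1}))
    (L.obsExt InFive .an) L.anBaseOverE L.κAn.inverse L.anObsIso L.κAn.fullyFaithfulInverse anJ L.anTel L.anTelIso
    (· = (anShape (Vmod := Vmod) (isArc := isArc)).obs) L.anW_ff rfl reach_an

/-- Its telecore edges are the printed ones. [cite: MochizukiAbsTopIII2015, Cor 5.5 (ii) p. 130] -/
theorem anTelecoreE_J : L.anTelecoreE.J = anJ := rfl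

/-- Its telecore functors are copies of `φ_{An•}`. [cite: MochizukiAbsTopIII2015, Cor 5.5 (ii) p. 130] -/
theorem anTelecoreE_telMap : HEq (fun (a : DSub (InFive (isArc := isArc))) (j : L.anTelecoreE.J a) => L.anTelecoreE.telMap j)
    (fun (a : DSub (InFive (isArc := isArc))) (j : TelecoreIdx a.1) => L.telecoreFun a.1 j) := HEq.rfl

/-- The telecore family of `𝔗_{An•}` on a pair `([γ₃]∘[γ₁], [γ₃]∘[γ₂])` (`[γ₁], [γ₂]` into `An•[𝒳]`) is the lift at `An•[𝒳]` whiskered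
by `[γ₃]` (Def 3.5 (iv) (b); this lineage's `univFamily_η_eq`). [cite: MochizukiAbsTopIII2015, Definition 3.5 (iv) p.76] -/
theorem anTelecoreE_Jfam_η {a b : (anShape (Vmod := Vmod) (isArc := isArc)).Vertex} {P Q : Path a b} (h : L.anTelecoreE.Jfam.E P Q)
    (p q : Path a (anShape (Vmod := Vmod) (isArc := isArc)).obs) (r : Path (anShape (Vmod := Vmod) (isArc := isArc)).obs b)
    (hP : P = p.comp r) (hQ : Q = q.comp r) :
    L.anTelecoreE.Jfam.η h = eqToHom (L.anDiagram.pathFunctor_eq_of_eq_comp p r hP) ≫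
      Functor.whiskerRight (L.anOverE.lift L.anOverE_ff_obs p q) (L.anDiagram.pathFunctor r) ≫
      eqToHom (L.anDiagram.pathFunctor_eq_of_eq_comp q r hQ).symm := by
  have hirr : L.anOverE.lift L.anOverE_ff_obs p q = L.anOverE.lift (L.anW_ff _ rfl) p q :=
    OverData.lift_ext _ _ _ (OverData.map_lift_app _ L.anOverE_ff_obs p q)
  rw [hirr]
  exact univFamily_η_eq L.anOverE (· = (anShape (Vmod := Vmod) (isArc := isArc)).obs) L.anW_ff _
    ⟨_, rfl, p, q, r, hP, hQ⟩

omit [Nonempty Vmod] in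
/-- `Cor55Telecore` from this telecore (a second witness next to abc-iut-L4-t15's `cor55Telecore_holds`; contact structure = a
restriction of the universal family). [cite: MochizukiAbsTopIII2015, Cor 5.5 (ii) pp. 130–131] -/
theorem cor55Telecore_of_anTelecoreE [Nonempty Vmod] : L.Cor55Telecore :=
  ⟨_, _, L.anCoreObsE_isCore, L.anTelecoreE, rfl, HEq.rfl,
    ⟨_, isContactStructure_restrictBoundary (D := L.subdiagram InFive) anObsShape
      (fun _ => (inferInstance : IsEmpty PEmpty.{u + 1})) (L.obsExt InFive .an) L.anBaseOverE L.κAn.inverse L.anObsIso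
      L.κAn.fullyFaithfulInverse anJ L.anTel L.anTelIso (· = (anShape (Vmod := Vmod) (isArc := isArc)).obs) L.anW_ff rfl
      reach_an _ (isSaturated_univE _)
      (univE_obs_subset (D := L.subdiagram InFive) anObsShape (L.obsExt InFive .an) L.anBaseOverE L.κAn.inverse L.anObsIso
        anJ L.anTel L.anTelIso (· = (anShape (Vmod := Vmod) (isArc := isArc)).obs) L.anW_ff rfl)⟩⟩

end LogFrobeniusSetting

/-! ## The three sub-observables read inside `D_{An•}`: one graph embedding -/

namespace LogFrobeniusSetting

open DiagramOfCategories

variable {Vmod : Type u} {isArc : Vmod → Bool} (L : LogFrobeniusSetting Vmod isArc)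

section Emb

variable (P : DVertex Vmod isArc → Prop) (xs : DVertex Vmod isArc) (hP : ∀ ⦃a : DVertex Vmod isArc⦄, P a → InFive (isArc := isArc) a)
  (hxs : InFive (isArc := isArc) xs)

/-- **The inclusion of oriented graphs `Γ⃗_{D_{≤P} ∪ {x}} ↪ Γ⃗_{D_{An•}}`** for a sub-diagram `D_{≤P} ⊆ D•_{≤5}` extended by an observation
vertex `x ∈ D•_{≤5}` (base vertices to themselves, the observation vertex to `x`): the common shape of abc-iut-L4-t3's `embPlus`
(`S_log⊞_v`), `embTS` (`S_log_v`), `embE5` (the core of (i) at `ℰ•`); reducible, so that the categories at its values unify with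
those of `D_{An•}` by instance resolution (as abc-iut-w5-d053's `plusToTS`). [cite: MochizukiAbsTopIII2015, Cor 5.5 (iii) p. 131] -/
@[reducible] def embObs : (obsShape P xs).Vertex ⥤q (anShape (Vmod := Vmod) (isArc := isArc)).Vertex where
  obj a := match a with
    | ExtVertex.base a => ExtVertex.base ⟨a.1, hP a.2⟩
    | ExtVertex.obs => ExtVertex.base ⟨xs, hxs⟩
  map {a b} e := match a, b, e with
    | ExtVertex.base _, ExtVertex.base _, e => e
    | ExtVertex.base _, ExtVertex.obs, i => i
    | ExtVertex.obs, ExtVertex.base _, j => PEmpty.elim j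
    | ExtVertex.obs, ExtVertex.obs, e => PEmpty.elim e

/-- The embedding lands in BASE vertices of `Γ⃗_{D_{An•}}` (never in the core vertex `An•[𝒳]`).
[cite: MochizukiAbsTopIII2015, Cor 5.5 (iii) p. 131] -/
theorem embObs_obj_ne_obs (a : (obsShape P xs).Vertex) :
    (embObs P xs hP hxs).obj a ≠ (anShape (Vmod := Vmod) (isArc := isArc)).obs := by
  cases a <;> exact fun h => by cases h

variable (hnot : ¬ P xs)

include hnot in
/-- It is an EMBEDDING of oriented graphs (abc-iut-f-101's `GraphEmbedding`), provided `x ∉ D_{≤P}`.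
[cite: MochizukiAbsTopIII2015, Section 0 p.26] -/
theorem graphEmbedding_embObs : GraphEmbedding (embObs P xs hP hxs) := by
  refine ⟨fun a b h => ?_, fun {a b} e e' h => ?_⟩
  · cases a with
    | base a =>
      cases b with
      | base b =>
        have h' := Subtype.mk.inj (ExtVertex.base.inj h)
        exact congrArg ExtVertex.base (Subtype.ext h')
      | obs => exact absurd (Subtype.mk.inj (ExtVertex.base.inj h) ▸ a.2) hnot
    | obs =>
      cases b with
      | base b => exact absurd ((Subtype.mk.inj (ExtVertex.base.inj h)).symm ▸ b.2) hnot
      | obs => rfl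
  · cases a with
    | base a =>
      cases b with
      | base b => exact h
      | obs => exact h
    | obs =>
      cases b with
      | base b => exact PEmpty.elim e
      | obs => exact PEmpty.elim e

/-- **The path functors agree along the embedding**: `D_{An•}` restricted along `Γ⃗_{D_{≤P} ∪ {x}} ↪ Γ⃗_{D_{An•}}` has the path
functors of the extended sub-diagram `D_{≤P} ∪ {x}` (same categories, same functors; Def 3.5 (i)).
[cite: MochizukiAbsTopIII2015, Definition 3.5 (i) p.75] -/
theorem pathFunctor_embObs :
    ∀ {a b : (obsShape P xs).Vertex} (p : Path a b),
      HEq (L.anDiagram.pathFunctor ((embObs P xs hP hxs).mapPath p)) (((L.subdiagram P).extend (L.obsExt P xs)).pathFunctor p) := by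
  intro a b p
  induction p with
  | nil =>
    rw [Prefunctor.mapPath_nil, pathFunctor_nil, pathFunctor_nil]
    cases a <;> rfl
  | cons p e ih =>
    rename_i c b
    rw [Prefunctor.mapPath_cons, pathFunctor_cons, pathFunctor_cons]
    revert ih
    cases a <;> cases c <;> cases b <;>
      first
        | exact (PEmpty.elim e)
        | (intro ih; rw [eq_of_heq ih]; rfl)

/-- The same as an EQUALITY of functors for paths into the observation vertex (the two path functors have the same type:
`D_{An•}` at `x` IS the category of `x`). [cite: MochizukiAbsTopIII2015, Definition 3.5 (i) p.75] -/
theorem pathFunctor_embObs_obs {a : (obsShape P xs).Vertex} (p : Path a (obsShape P xs).obs) :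
    L.anDiagram.pathFunctor ((embObs P xs hP hxs).mapPath p) =
      (by cases a <;> exact ((L.subdiagram P).extend (L.obsExt P xs)).pathFunctor p) := by
  have h := L.pathFunctor_embObs P xs hP hxs p
  revert h p
  cases a <;> intro p h <;> exact eq_of_heq h

end Emb

end LogFrobeniusSetting

end Literature.AnabelianGeometry.AbsoluteAnabelian

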